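import Mathlib
import Summits.KontsevichZagierPeriods.Zeta5Search.WedgeDictionaryRec3
import Summits.KontsevichZagierPeriods.Zeta5Search.DualSeriesContiguity
import Summits.KontsevichZagierPeriods.Zeta5Search.Elimination.DictStarTransport
import HarnessLib

/-!
# The top relation at `d = 1`: a THREE-term relation for `U`, `W` along a slot (cell `pub-zeta5`, ct-1 g24)

HONEST FRAMING: systematic search; no irrationality claim unless certified.  Identities among the cell's rational dictionary
data (the canonical coefficients `U = coeffU`, `W = coeffW` of the dual very-well-poised series); nothing about integrals,
sizes or ζ(5); records in print UNMOVED.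

OUR work (Summit side; seat `pub-zeta5-ct-1` generation 24, 2026-08-26).  gen-1 g5's polynomial identity `top_fourTerm`
(`WedgeDictionaryTopRelation`) holds for every box point `b`:
`γ₃·numPoly(b+3e₇) + γ₂·numPoly(b+2e₇) + γ₁·numPoly(b+e₇) + γ₀·numPoly(b) = g(X+1)X⁶ − g(X)(X+N)⁶`, `g = topTelescoper b`,
with `γ₃ = −(d(b) − 1)` (`topGamma3_eq`).  lit g4's `fourTerm_coeff_rel` (`WedgeDictionaryRec3`) turns it into the four-term relation
for `U`, `W` under `d(b) ≥ 2`, where the telescoper has `deg g + 1 ≤ 6N` as the summability principle `coeff_rel_of_summable_sum`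
requires.  AT `d(b) = 1` the coefficient `γ₃` VANISHES and `deg g = 6N` exactly; this file shows that the summability principle
survives `deg g ≤ 6N` (the leading multiple of the Pochhammer power `(X)_N⁶` telescopes to zero:
`(X+1)_N⁶·X⁶ = (X)_N⁶·(X+N)⁶`), whence the THREE-TERM relation

  `γ₂(b)·Λ(b+2e₇) + γ₁(b)·Λ(b+e₇) + γ₀(b)·Λ(b) = 0`,  `Λ ∈ {U, W}`,  `b` in the box, `d(b) = 1`, `b₇ + 1 ≤ N`

(`top_threeTerm_dOne`), and along every slot `s+1` by the `S₇`-invariance of `U`, `W` (`top_threeTerm_dOne_slot`, coefficients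
`γ_k(σ•b)` for the transposition `σ = (s 6)` of `Fin 7`).  This is the frame relation "at the `d`-boundary" that the tree's
(L1)/(L2)/pencil machinery (all stated for `d ≥ 2` at the base) did not reach; ct-1 g24 uses it for the `d`-interface law of `Q` in
the proof of Brown–Zudilin's decomposition (4) on the whole cone.
Exact check before formalisation (seat folder `code/toprel.py`): 47 238 instances `(b, Λ)` of levels `≤ 5`, 0 failures.

* `pochPow_shift` — `((X)_N⁶).comp(X+1)·X⁶ = (X)_N⁶·(X+N)⁶`;
* `coeff_rel_of_summable_sum_le` — lit g4's summability principle with `deg g ≤ 6N`;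
* `natDegree_topTelescoper_le_dOne`, **`top_threeTerm_dOne`**, **`top_threeTerm_dOne_slot`**;
* `lawD_scalar_identity` — the one polynomial identity (under `d = 1`) used by the `d`-interface law (ct-1 g24, next file).
-/

noncomputable section

open Finset Polynomial

namespace Summit.KontsevichZagierPeriods.Zeta5Search.WedgeDictionary

open Summit.KontsevichZagierPeriods.Zeta5Search.DualSeries
open Summit.KontsevichZagierPeriods.Zeta5Search.SymmetricGauge (permLower coeffU_permLower coeffW_permLower dOf_permLower)
open Summit.KontsevichZagierPeriods.Zeta5Search.Elimination (permLower_bump inBox_permLower permLower_vals)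
open Literature.NumberTheory.Transcendental
open Literature.NumberTheory.Transcendental.BallRivoal (pochPoly)

/-! ### 1. The Pochhammer power telescopes to zero -/

/-- `(X)_N.comp(X + 1) = (X + 1)_N`. -/
theorem pochPoly_zero_comp_succ (N : ℕ) : (pochPoly 0 N).comp (X + C 1) = pochPoly 1 N := by
  induction N with
  | zero => simp [pochPoly]
  | succ n ih =>
    have h1 : pochPoly 1 (n + 1) = pochPoly 1 n * (X + C (1 + (n : ℚ))) := by
      unfold pochPoly; rw [prod_range_succ]
    rw [pochPoly_zero_succ, mul_comp, ih, h1, add_comp, X_comp, C_comp]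
    congr 1
    simp only [map_add, map_natCast]
    ring

/-- `(X + 1)_N · X = (X)_N · (X + N)`. -/
theorem pochPoly_one_mul_X (N : ℕ) : pochPoly 1 N * X = pochPoly 0 N * (X + C (N : ℚ)) := by
  have h := pochPoly_succ_left 0 N
  rw [pochPoly_zero_succ, zero_add, map_zero, add_zero] at h
  rw [mul_comm (pochPoly 1 N) X]
  exact h.symm

/-- **The Pochhammer power telescopes**: `((X)_N⁶).comp(X+1)·X⁶ = (X)_N⁶·(X+N)⁶`. -/
theorem pochPow_shift (N : ℕ) :
    ((pochPoly 0 N) ^ 6).comp (X + C 1) * X ^ 6 = (pochPoly 0 N) ^ 6 * (X + C (N : ℚ)) ^ 6 := by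
  rw [pow_comp, pochPoly_zero_comp_succ, ← mul_pow, ← mul_pow, pochPoly_one_mul_X]

/-- `(X)_N⁶` is monic of degree `6N`. -/
theorem pochPow_monic_natDegree (N : ℕ) :
    ((pochPoly 0 N) ^ 6).Monic ∧ ((pochPoly 0 N) ^ 6).natDegree = 6 * N := by
  have hm : (pochPoly 0 N).Monic := by
    unfold pochPoly
    exact monic_prod_of_monic _ _ fun s _ => monic_X_add_C _
  have hd : (pochPoly 0 N).natDegree = N := by
    unfold pochPoly
    rw [natDegree_prod_of_monic _ _ fun s _ => monic_X_add_C _, Finset.sum_congr rfl fun s _ => natDegree_X_add_C _]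
    simp
  refine ⟨hm.pow 6, ?_⟩
  rw [hm.natDegree_pow, hd]

/-! ### 2. The summability principle with `deg g ≤ 6N` -/

/-- **lit g4's summability principle, relaxed to `deg g ≤ 6N`.**  If a finite combination `Σᵢ cᵢ·numPoly(bᵢ)` of numerators at a
common level `N ≥ 1` (box points with `Σ_j (bᵢ)_j ≤ 3N + 1`) equals `g(X+1)·X⁶ − g·(X+N)⁶` with `deg g ≤ 6N`, then
`Σᵢ cᵢ·U(bᵢ) = 0 = Σᵢ cᵢ·W(bᵢ)`: subtracting `g.coeff(6N)·(X)_N⁶` from `g` does not change the right-hand side (`pochPow_shift`)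
and brings the degree below `6N`. -/
theorem coeff_rel_of_summable_sum_le {ι : Type*} (s : Finset ι) (bv : ι → ℕ → ℤ) (c : ι → ℚ) (N : ℕ) (hN : 1 ≤ N)
    (hbox : ∀ i ∈ s, InBox (bv i)) (hsum : ∀ i ∈ s, ∑ j ∈ range 7, bv i (j + 1) ≤ 3 * bv i 0 + 1)
    (hlev : ∀ i ∈ s, (bv i 0).toNat = N) (g : ℚ[X]) (hg : g.natDegree ≤ 6 * N)
    (hrel : ∑ i ∈ s, C (c i) * numPoly (bv i) = g.comp (X + C 1) * X ^ 6 - g * (X + C (N : ℚ)) ^ 6) :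
    ∑ i ∈ s, c i * coeffU (bv i) = 0 ∧ ∑ i ∈ s, c i * coeffW (bv i) = 0 := by
  obtain ⟨hPm, hPd⟩ := pochPow_monic_natDegree N
  set P : ℚ[X] := (pochPoly 0 N) ^ 6 with hP
  set g' : ℚ[X] := g - C (g.coeff (6 * N)) * P with hg'
  have hshift := pochPow_shift N
  have hrel' : g'.comp (X + C 1) * X ^ 6 - g' * (X + C (N : ℚ)) ^ 6 =
      g.comp (X + C 1) * X ^ 6 - g * (X + C (N : ℚ)) ^ 6 := by
    simp only [hg', sub_comp, mul_comp, C_comp]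
    linear_combination (-(C (g.coeff (6 * N)))) * hshift
  have hcoeff : ∀ m, 6 * N ≤ m → g'.coeff m = 0 := by
    intro m hm
    simp only [hg', coeff_sub, coeff_C_mul]
    rcases eq_or_lt_of_le hm with h | h
    · rw [← h, show P.coeff (6 * N) = 1 from by rw [← hPd]; exact hPm.coeff_natDegree]
      ring
    · rw [coeff_eq_zero_of_natDegree_lt (lt_of_le_of_lt hg h),
        coeff_eq_zero_of_natDegree_lt (show P.natDegree < m by rw [hPd]; exact h)]
      ring
  have hdeg' : g'.natDegree + 1 ≤ 6 * N := by
    by_cases h0 : g' = 0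
    · rw [h0, natDegree_zero]; omega
    · have hlt : g'.degree < ((6 * N : ℕ) : WithBot ℕ) := (degree_lt_iff_coeff_zero g' (6 * N)).2 hcoeff
      have := (natDegree_lt_iff_degree_lt h0).2 hlt
      omega
  exact coeff_rel_of_summable_sum s bv c N hN hbox hsum hlev g' hdeg' (hrel.trans hrel'.symm)

/-! ### 3. The three-term relation at `d = 1` -/

/-- At `d(b) = 1` the telescoper has degree `≤ 6N` (one more than lit g4's bound allows directly). -/
theorem natDegree_topTelescoper_le_dOne (b : ℕ → ℤ) (hb : InBox b) (hd : dOf b = 1) :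
    (topTelescoper b).natDegree ≤ 6 * (b 0).toNat := by
  have h1 := natDegree_hPoly_le b
  have h2 : ((X + C (b 0 : ℚ)) * (X - C 1)).natDegree ≤ 2 := by
    refine natDegree_mul_le.trans ?_
    rw [natDegree_X_add_C, natDegree_X_sub_C]
  have h3 : (topTelescoper b).natDegree ≤ 2 + ∑ j ∈ range 7, 2 * (b (j + 1)).toNat := by
    unfold topTelescoper
    exact natDegree_mul_le.trans (add_le_add h2 h1)
  obtain ⟨h0, hj⟩ := hb
  have hb0 : (b 0 : ℤ) = ((b 0).toNat : ℤ) := (Int.toNat_of_nonneg h0).symm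
  have hS : ∑ j ∈ range 7, b (j + 1) = ((∑ j ∈ range 7, (b (j + 1)).toNat : ℕ) : ℤ) := by
    rw [Nat.cast_sum]
    exact sum_congr rfl fun j hj' => (Int.toNat_of_nonneg (hj j hj').1).symm
  have h4 : ∑ j ∈ range 7, 2 * (b (j + 1)).toNat = 2 * ∑ j ∈ range 7, (b (j + 1)).toNat := by rw [mul_sum]
  unfold dOf at hd
  rw [hS, hb0] at hd
  omega

/-- **The three-term top relation at `d = 1` (slot 7).**  For `b` in the box with `d(b) = 1` and `b₇ + 1 ≤ N`:
`γ₂(b)·Λ(b+2e₇) + γ₁(b)·Λ(b+e₇) + γ₀(b)·Λ(b) = 0` for `Λ = U, W` (`γ_k = topGamma_k b`; here `γ₃(b) = 0`). -/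
theorem top_threeTerm_dOne (b : ℕ → ℤ) (hb : InBox b) (hd : dOf b = 1) (h7 : b 7 + 1 ≤ b 0) :
    (topGamma2 b * coeffU (bump (bump b 6) 6) + topGamma1 b * coeffU (bump b 6) + topGamma0 b * coeffU b = 0) ∧
      (topGamma2 b * coeffW (bump (bump b 6) 6) + topGamma1 b * coeffW (bump b 6) + topGamma0 b * coeffW b = 0) := by
  have hi7 : (6 : ℕ) ∈ range 7 := mem_range.2 (by norm_num)
  set b1 := bump b 6 with hb1def
  set b2 := bump b1 6 with hb2def
  set b3 := bump b2 6 with hb3def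
  have e10 : b1 0 = b 0 := bump_zero b 6
  have e20 : b2 0 = b 0 := (bump_zero b1 6).trans e10
  have e17 : b1 7 = b 7 + 1 := bump6_seven b
  have hd1 : dOf b1 = dOf b - 1 := dOf_bump b hi7
  have hd2 : dOf b2 = dOf b - 2 := by rw [hb2def, dOf_bump b1 hi7, hd1]; ring
  have hB1 : InBox b1 := inBox_bump6 b hb (by omega)
  have hB2 : InBox b2 := inBox_bump6 b1 hB1 (by rw [e17, e10]; omega)
  have hN : 1 ≤ (b 0).toNat := by have h70 : 0 ≤ b 7 := (hb.2 6 hi7).1; omega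
  have hγ3 : topGamma3 b = 0 := by rw [topGamma3_eq, hd]; norm_num
  have key := coeff_rel_of_summable_sum_le (Finset.univ : Finset (Fin 3)) ![b, b1, b2]
    ![topGamma0 b, topGamma1 b, topGamma2 b] (b 0).toNat hN
    (by
      intro i _
      fin_cases i
      · exact hb
      · exact hB1
      · exact hB2)
    (by
      intro i _
      fin_cases i
      · show ∑ j ∈ range 7, b (j + 1) ≤ 3 * b 0 + 1
        rw [sum_slots_eq]; omega
      · show ∑ j ∈ range 7, b1 (j + 1) ≤ 3 * b1 0 + 1
        rw [sum_slots_eq, hd1]; omega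
      · show ∑ j ∈ range 7, b2 (j + 1) ≤ 3 * b2 0 + 1
        rw [sum_slots_eq, hd2]; omega)
    (by
      intro i _
      fin_cases i
      · rfl
      · show (b1 0).toNat = (b 0).toNat
        rw [e10]
      · show (b2 0).toNat = (b 0).toNat
        rw [e20])
    (topTelescoper b) (natDegree_topTelescoper_le_dOne b hb hd)
    (by
      rw [Fin.sum_univ_three]
      show C (topGamma0 b) * numPoly b + C (topGamma1 b) * numPoly b1 + C (topGamma2 b) * numPoly b2 = _
      rw [← top_fourTerm b hb, hγ3, map_zero, zero_mul, zero_add]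
      ring)
  rw [Fin.sum_univ_three, Fin.sum_univ_three] at key
  obtain ⟨kU, kW⟩ := key
  change topGamma0 b * coeffU b + topGamma1 b * coeffU b1 + topGamma2 b * coeffU b2 = 0 at kU
  change topGamma0 b * coeffW b + topGamma1 b * coeffW b1 + topGamma2 b * coeffW b2 = 0 at kW
  constructor
  · linear_combination kU
  · linear_combination kW

/-- **The three-term top relation at `d = 1` along the slot `s+1`** (`s : Fin 7`), by the `S₇`-invariance of `U`, `W`
(`coeffU_permLower`, `coeffW_permLower`): with `σ = (s 6)` and `b = σ • x`,
`γ₂(b)·Λ(x+2e_{s+1}) + γ₁(b)·Λ(x+e_{s+1}) + γ₀(b)·Λ(x) = 0` for `x` in the box with `d(x) = 1`, `x_{s+1} + 1 ≤ x₀`. -/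
theorem top_threeTerm_dOne_slot (x : ℕ → ℤ) (s : Fin 7) (hx : InBox x) (hd : dOf x = 1) (hs : x (s.val + 1) + 1 ≤ x 0) :
    (topGamma2 (permLower (Equiv.swap s 6) x) * coeffU (bump (bump x s.val) s.val) +
        topGamma1 (permLower (Equiv.swap s 6) x) * coeffU (bump x s.val) +
        topGamma0 (permLower (Equiv.swap s 6) x) * coeffU x = 0) ∧
      (topGamma2 (permLower (Equiv.swap s 6) x) * coeffW (bump (bump x s.val) s.val) +
        topGamma1 (permLower (Equiv.swap s 6) x) * coeffW (bump x s.val) +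
        topGamma0 (permLower (Equiv.swap s 6) x) * coeffW x = 0) := by
  have hσ6 : (Equiv.swap s 6 : Equiv.Perm (Fin 7)) 6 = s := Equiv.swap_apply_right _ _
  have hbI : InBox (permLower (Equiv.swap s 6) x) := inBox_permLower _ hx
  have hbd : dOf (permLower (Equiv.swap s 6) x) = 1 := by rw [dOf_permLower]; exact hd
  obtain ⟨hb0, -, -, -, -, -, -, hb7⟩ := permLower_vals (Equiv.swap s 6) x
  rw [hσ6] at hb7
  have e1 : bump (permLower (Equiv.swap s 6) x) 6 = permLower (Equiv.swap s 6) (bump x s.val) := by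
    have h := permLower_bump (Equiv.swap s 6) x 6
    rw [hσ6] at h
    exact h
  have e2 : bump (bump (permLower (Equiv.swap s 6) x) 6) 6 = permLower (Equiv.swap s 6) (bump (bump x s.val) s.val) := by
    rw [e1]
    have h := permLower_bump (Equiv.swap s 6) (bump x s.val) 6
    rw [hσ6] at h
    exact h
  have key := top_threeTerm_dOne (permLower (Equiv.swap s 6) x) hbI hbd (by rw [hb7, hb0]; exact hs)
  rw [e2, e1] at key
  simp only [coeffU_permLower, coeffW_permLower] at key
  exact key

/-! ### 4. The scalar identity of the `d`-interface law -/

set_option maxHeartbeats 400000 in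
/-- **The polynomial identity behind the `d`-interface law** (ct-1 g24).  For `b` with `d(b) = 1` (the constraint enters through
`b₆ = 3N − 1 − b₁ − ⋯ − b₅ − b₇`), writing `β = b₇`:
`∏_{k≤6}(b_k + 1) − ∏_{k≤6}(N − β − b_k) = (N − β + 1)·(γ₁(b) + (β+2)(N−β)·γ₂(b))` (`γ_k = topGamma_k b`).
Together with `γ₀(b) = (β+1)·∏_{k≤6}(N − β − b_k)` (`topGamma0_eq`) this is the scalar identity of the `d`-interface law.
Exact check before formalisation: `code/scheck2.py`, 4 000 random instances with `d = 1`, 0 failures (the identity is FALSE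
without the constraint `d = 1`). -/
theorem lawD_scalar_identity (b : ℕ → ℤ) (hd : dOf b = 1) :
    (∏ k ∈ range 6, ((b (k + 1) : ℚ) + 1)) - ∏ k ∈ range 6, ((b 0 : ℚ) - b 7 - b (k + 1)) =
      ((b 0 : ℚ) - b 7 + 1) * (topGamma1 b + ((b 7 : ℚ) + 2) * ((b 0 : ℚ) - b 7) * topGamma2 b) := by
  have h6 : (b 6 : ℚ) = 3 * (b 0 : ℚ) - 1 - b 1 - b 2 - b 3 - b 4 - b 5 - b 7 := by
    have h : b 6 = 3 * b 0 - 1 - b 1 - b 2 - b 3 - b 4 - b 5 - b 7 := by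
      unfold dOf at hd
      simp only [sum_range_succ, sum_range_zero, Nat.reduceAdd, zero_add] at hd
      omega
    exact_mod_cast h
  simp only [topGamma1, topGamma2, topA1, topA2, topA3, yNode, fe1, fe2, fe3, fe4, fe5,
    prod_range_succ, prod_range_zero, Nat.reduceAdd]
  simp only [one_mul]
  rw [h6]
  ring

end Summit.KontsevichZagierPeriods.Zeta5Search.WedgeDictionary

end
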